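import Literature.Computability.AlgebraicComplexity.RealTauKnownCases
import Summits.ValiantsHypothesis.ValiantsHypothesis.Theorems.KPlusLogSqLawTridiagonalRealStaticPotentialRow

/-!
# Route «KPlusLogSqLaw», crux `WeakLifting` (stmt-ValiantsHypothesis-19561) — REAL side of the tridiagonal sector:
# the first two steps of conjecture (P) hold — `(P)_0`, `(P)_1` — and the conditional row is unconditional up to size `3`

HONEST FRAMING.  Helper (`--supports stmt-ValiantsHypothesis-19561 --as helper`), seat val-sym-lift-p3 (g10), cell `pub-symmetroid`,
2026-08-27; the first RUNGS of the reduction of the desk's α target to conjecture (P) (R2278: «a first kernel instance … would be a fine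
rung»; `(P)_2` = «(P) at `m = 4`» is NOT here).  Elementary: by Descartes' rule of signs (Mathlib `roots_countP_pos_le_signVariations`, the
tree's `signVariations_lt_card_support`) `D₁ = a₀X^{d₀}` has no positive zero, the binomial `D₂` at most one and the trinomial `D₃` at
most two, counted WITH multiplicity; the potential never exceeds the length of the root word (`theta_le_length`), which is the number of
positive zeros of the two continuants with multiplicity (`length_rootWord`); and a positive zero of `D₂` is a `q`-letter of
`rootWord D₁ D₂`.  Hence `Θ(rootWord D₁ D₂) ≤ 1 ≤ Θ(rootWord D₀ D₁) + 2` (`potentialStep_zero`) and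
`Θ(rootWord D₂ D₃) ≤ #posRoots(D₂) + 2 ≤ Θ(rootWord D₁ D₂) + 2` (`potentialStep_one`); with the Row file's bounded form the row
`card posRoots ≤ 2m − 2` is UNCONDITIONAL for `m ≤ 3` (`card_posRoots_le_of_size_le_three`; the sharp kernel values `B 2 = 1`, `B 3 = 2`
of the cell are of course stronger — this is a sanity instance of the reduction, not a new row).  (P) itself stays OPEN; α does not move.
Nothing here bears on `WeakLifting` / `TropicalB` (stmt-19771) in their windows, on Conjecture B, on the Door-A registers, on
`MatrixDescartes` (stmt-ValiantsHypothesis-18050) or on VP ≠ VNP.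
[folklore: Descartes' rule of signs for fewnomials; this cell's memo HIERARCHICAL-LIMIT-GAME-liftp3g9.md §7b]
-/

-- `Summit.ValiantsHypothesis.ValiantsHypothesis.…` repeats a component by the D-0017 layout (single-conjunct summit); the name is mandated.
set_option linter.dupNamespace false
set_option autoImplicit false

namespace Summit.ValiantsHypothesis.ValiantsHypothesis.Theorems.KPlusLogSqLaw

namespace StaticTridiagonalRealPotential

open Polynomial Finset

variable (a : ℕ → ℝ) (d : ℕ → ℕ) (b : ℕ → ℝ) (f : ℕ → ℕ)

/-! ### The first two steps of (P) hold unconditionally -/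

section Steps

open Literature.Computability.AlgebraicComplexity (signVariations_lt_card_support)

/-- `Θ(w) ≤ |w|`: agreements never exceed the number of positions. -/
theorem theta_le_length (w : List Bool) : theta w ≤ w.length := by
  classical
  unfold theta
  refine Finset.sup_le fun lab _ => ?_
  exact (Nat.sub_le _ _).trans ((Finset.card_filter_le _ _).trans (by simp))

/-- Over a finset of positive reals containing the positive roots of `Q ≠ 0`, the root multiplicities of `Q` sum to the number of
positive roots of `Q` counted with multiplicity. [folklore] -/
theorem sum_rootMultiplicity_eq {Q : ℝ[X]} (S : Finset ℝ) (hS : ∀ x ∈ S, 0 < x)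
    (hsub : Q.roots.toFinset.filter (fun x => 0 < x) ⊆ S) :
    ∑ x ∈ S, Q.rootMultiplicity x = Q.roots.countP (fun x => 0 < x) := by
  classical
  rw [Multiset.countP_eq_card_filter, ← Multiset.toFinset_sum_count_eq, Multiset.toFinset_filter,
    ← Finset.sum_subset hsub]
  · refine Finset.sum_congr rfl fun x hx => ?_
    rw [Finset.mem_filter] at hx
    rw [Multiset.count_filter_of_pos hx.2, Polynomial.count_roots]
  · intro x hxS hx
    rw [Finset.mem_filter, Multiset.mem_toFinset, not_and] at hx
    by_cases hQ : Q = 0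
    · simp [hQ]
    · exact Polynomial.rootMultiplicity_eq_zero fun hr => hx ((Polynomial.mem_roots hQ).2 hr) (hS x hxS)

/-- **Length of the root word** = positive roots of `P` plus positive roots of `Q`, with multiplicity (`P · Q ≠ 0`). [folklore] -/
theorem length_rootWord {P Q : ℝ[X]} (hPQ : P * Q ≠ 0) :
    (rootWord P Q).length = P.roots.countP (fun x => 0 < x) + Q.roots.countP (fun x => 0 < x) := by
  classical
  have hP : P ≠ 0 := left_ne_zero_of_mul hPQ
  have hQ : Q ≠ 0 := right_ne_zero_of_mul hPQ
  unfold rootWord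
  rw [List.length_flatMap]
  set s := (P * Q).roots.toFinset.filter (fun x => 0 < x) with hs
  have hnd : (s.sort (· ≤ ·)).Nodup := Finset.sort_nodup _ _
  rw [← List.sum_toFinset _ hnd, Finset.sort_toFinset]
  simp only [List.length_append, List.length_replicate]
  have hSpos : ∀ x ∈ s, 0 < x := fun x hx => (Finset.mem_filter.1 hx).2
  rw [Finset.sum_add_distrib, sum_rootMultiplicity_eq s hSpos ?_, sum_rootMultiplicity_eq s hSpos ?_]
  · intro x hx
    rw [Finset.mem_filter, Multiset.mem_toFinset] at hx ⊢
    exact ⟨by rw [Polynomial.roots_mul hPQ]; exact Multiset.mem_add.2 (Or.inr hx.1), hx.2⟩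
  · intro x hx
    rw [Finset.mem_filter, Multiset.mem_toFinset] at hx ⊢
    exact ⟨by rw [Polynomial.roots_mul hPQ]; exact Multiset.mem_add.2 (Or.inl hx.1), hx.2⟩

/-- If `P · Q = 0` the root word is empty. -/
theorem rootWord_eq_nil_of_mul_eq_zero {P Q : ℝ[X]} (h : P * Q = 0) : rootWord P Q = [] := by
  classical
  unfold rootWord
  rw [h, Polynomial.roots_zero]
  simp

/-- Positive roots with multiplicity are bounded by the number of terms minus one (Descartes' rule of signs, Mathlib
`roots_countP_pos_le_signVariations`, and `Var(P) < #support P`). [folklore: Descartes] -/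
theorem countP_roots_pos_le_of_card_support_le {P : ℝ[X]} {n : ℕ} (h : P.support.card ≤ n + 1) :
    P.roots.countP (fun x => 0 < x) ≤ n := by
  by_cases hP : P = 0
  · simp [hP]
  · have h1 := P.roots_countP_pos_le_signVariations
    have h2 := signVariations_lt_card_support hP
    omega

/-- `D₂ = a₁a₀ X^{d₁+d₀} − b₀² X^{2f₀}` (a binomial). [folklore] -/
theorem pathDet_two : pathDet a d b f 2 = C (a 1 * a 0) * X ^ (d 1 + d 0) + C (-(b 0 ^ 2)) * X ^ (2 * f 0) := by
  rw [pathDet_add_two, pathDet_one, pathDet_zero]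
  simp only [map_mul, map_neg, map_pow]
  ring

/-- `D₃ = a₂a₁a₀ X^{d₂+d₁+d₀} − a₂b₀² X^{d₂+2f₀} − b₁²a₀ X^{2f₁+d₀}` (a trinomial). [folklore] -/
theorem pathDet_three : pathDet a d b f 3 =
    C (a 2 * (a 1 * a 0)) * X ^ (d 2 + (d 1 + d 0)) + C (a 2 * -(b 0 ^ 2)) * X ^ (d 2 + 2 * f 0) +
      C (-(b 1 ^ 2) * a 0) * X ^ (2 * f 1 + d 0) := by
  rw [show (3 : ℕ) = 1 + 2 from rfl, pathDet_add_two, pathDet_two, pathDet_one]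
  simp only [map_mul, map_neg, map_pow]
  ring

/-- `D₁` has no positive root. -/
theorem countP_roots_pos_pathDet_one : (pathDet a d b f 1).roots.countP (fun x => 0 < x) = 0 := by
  refine Nat.le_zero.1 (countP_roots_pos_le_of_card_support_le ?_)
  rw [pathDet_one]
  exact (Polynomial.card_support_C_mul_X_pow_le_one).trans (by norm_num)

/-- `D₂` has at most one positive root, counted with multiplicity. -/
theorem countP_roots_pos_pathDet_two : (pathDet a d b f 2).roots.countP (fun x => 0 < x) ≤ 1 := by
  refine countP_roots_pos_le_of_card_support_le ?_
  rw [pathDet_two]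
  exact (Finset.card_le_card (Polynomial.support_binomial_subset _ _ _ _)).trans (Finset.card_le_two)

/-- `D₃` has at most two positive roots, counted with multiplicity. -/
theorem countP_roots_pos_pathDet_three : (pathDet a d b f 3).roots.countP (fun x => 0 < x) ≤ 2 := by
  refine countP_roots_pos_le_of_card_support_le ?_
  rw [pathDet_three]
  exact (Finset.card_le_card (Polynomial.support_trinomial_subset _ _ _ _ _ _)).trans (Finset.card_le_three)

/-- **Step `(P)_0` holds**: `Θ(rootWord D₁ D₂) ≤ 1 ≤ Θ(rootWord D₀ D₁) + 2`. [this file] -/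
theorem potentialStep_zero : PotentialStep 0 := by
  intro a d b f ha hb
  show theta (rootWord (pathDet a d b f 1) (pathDet a d b f 2)) ≤ theta (rootWord (pathDet a d b f 0) (pathDet a d b f 1)) + 2
  refine (theta_le_length _).trans ?_
  by_cases h : pathDet a d b f 1 * pathDet a d b f 2 = 0
  · rw [rootWord_eq_nil_of_mul_eq_zero h]; simp
  · rw [length_rootWord h, countP_roots_pos_pathDet_one]
    have := countP_roots_pos_pathDet_two a d b f
    omega

/-- **Step `(P)_1` holds**: `Θ(rootWord D₂ D₃) ≤ #posRoots(D₂) + 2 ≤ Θ(rootWord D₁ D₂) + 2` (a positive root of `D₂` is a `q`-letter of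
`rootWord D₁ D₂`). [this file] -/
theorem potentialStep_one : PotentialStep 1 := by
  classical
  intro a d b f ha hb
  show theta (rootWord (pathDet a d b f 2) (pathDet a d b f 3)) ≤ theta (rootWord (pathDet a d b f 1) (pathDet a d b f 2)) + 2
  by_cases h : pathDet a d b f 2 * pathDet a d b f 3 = 0
  · rw [rootWord_eq_nil_of_mul_eq_zero h, theta_nil]; exact Nat.zero_le _
  · refine (theta_le_length _).trans ?_
    rw [length_rootWord h]
    have h3 := countP_roots_pos_pathDet_three a d b f
    have h2 := countP_roots_pos_pathDet_two a d b f
    by_cases h0 : (pathDet a d b f 2).roots.countP (fun x => 0 < x) = 0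
    · omega
    · -- `D₂` has a positive root, which is a `q`-letter of `rootWord D₁ D₂`
      have hD2 : pathDet a d b f 2 ≠ 0 := left_ne_zero_of_mul h
      have hD1 : pathDet a d b f 1 ≠ 0 := by
        rw [pathDet_one]; exact mul_ne_zero (by rw [Ne, C_eq_zero]; exact (ha 0).ne') (pow_ne_zero _ X_ne_zero)
      obtain ⟨x, hx, hxpos⟩ := Multiset.countP_pos.1 (Nat.pos_of_ne_zero h0)
      have hcard : 1 ≤ ((pathDet a d b f 2).roots.toFinset.filter (fun x => 0 < x)).card :=
        Finset.card_pos.2 ⟨x, Finset.mem_filter.2 ⟨Multiset.mem_toFinset.2 hx, hxpos⟩⟩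
      have hth := (card_posRoots_le_count_true (mul_ne_zero hD1 hD2)).trans (count_le_theta _ true)
      omega

/-- Hence the steps of (P) needed up to size `3` all hold, and the conditional row is UNCONDITIONAL there (a sanity instance of the
reduction; the sharp kernel values `B 2 = 1`, `B 3 = 2` are of course stronger). [corollary] -/
theorem card_posRoots_le_of_size_le_three (m : ℕ) (hm : m ≤ 3)
    (c : Fin m → Fin m → ℝ) (e : Fin m → Fin m → ℕ) (hc : ∀ i j, c i j = c j i) (he : ∀ i j, e i j = e j i)
    (hband : ∀ i j : Fin m, (i : ℕ) + 1 < j ∨ (j : ℕ) + 1 < i → c i j = 0) (hpos : ∀ i, 0 < c i i) :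
    ((Matrix.det (Matrix.of fun i j => C (c i j) * (X : ℝ[X]) ^ e i j)).roots.toFinset.filter
      (fun t : ℝ => 0 < t)).card ≤ 2 * m - 2 := by
  refine card_posRoots_le_of_potentialSteps m (fun j hj => ?_) c e hc he hband hpos
  have hj1 : j ≤ 1 := by omega
  interval_cases j
  · exact potentialStep_zero
  · exact potentialStep_one

end Steps

end StaticTridiagonalRealPotential

end Summit.ValiantsHypothesis.ValiantsHypothesis.Theorems.KPlusLogSqLaw
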